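import Summits.HubbardSuperconductivity.HubbardSuperconductivity.Theorems.BalabanIRBirEveryGroundStateTransfer
import Summits.HubbardSuperconductivity.HubbardSuperconductivity.Theorems.BalabanIRBirEveryGroundStateResidue

/-!
# Disproof of `BirEveryGroundState` — findings (cdisprove, gen 2 / cycle 2, 2026-08-16)

Crux `stmt-HubbardSuperconductivity-2083` = `Theses.BalabanIR.BirEveryGroundState` (route BalabanIR,
rank 5): AVERAGE → EVERY. For `δ ∈ (0,1/2)`, `0 < U₁ < U₂`, `c > 0`: if at every coupling `U` of the
window, eventually in even `L`, `c·L⁴·Re tr P ≤ Re tr (P Δ_d†Δ_d)` (`P` = projection onto the sector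
ground eigenspace `E₀(U,L)` of `hubbardTorus 2 L 1 U` in `(2⌊(1-δ)L²/2⌋, S^z = 0)`), then at SOME `U` of
the window EVERY admissible normalised sector ground-state sequence has `d_{x²-y²}` pair-field LRO.

## VERDICT (standing): NO KILL — the crux is insulated on both sides
* `¬S` needs data `(δ,U₁,U₂,c)` for which the window-average hypothesis HOLDS (this is the route's
  open target `BirGroundStateAverageLRO` restricted to that window: ground-state-average d-wave pair
  LRO of doped repulsive 2D Hubbard tori — no instance is provable) AND dark ground states infinitely
  often at EVERY coupling of the window (`Theorems.exists_darkGroundStates_of_not_birEveryGroundState`).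
  No junk regime makes the hypothesis cheap: `Re tr P ≥ 1` (`one_le_re_trace_groundProj_hubbardTorus`),
  `0 ≤ Re tr (PΔ†Δ) ≤ C_d² L⁴ Re tr P` (`re_trace_sectorGroundProj_mul_pairField_mem_Icc`), the
  `liminf` sequence is bounded, `L = 0` is the harmless vacuum torus, sectors are non-empty.
* Vacuity (hypothesis never satisfiable ⇒ crux trivially TRUE) is equally out of reach: it would be
  an `o(L⁴)` upper bound on the ground-state AVERAGE of `Δ_d†Δ_d` at some `U` of every window —
  absence of d-wave pair order in doped Hubbard ground states, unproved at any `U > 0`.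
* The positive side (prover seat 3, p69460…p77900) closed the crux modulo ONE model-specific
  genericity statement (closers `birEveryGroundState_structural_of_{transfer,scalarOnGround,
  simpleGround,darkPartnerExclusion,irreducibleGround,kappaChord,moments}`); `birEveryGroundState_iff_transfer`
  shows the transfer form IS the crux. This file attacks that residual where it can be attacked.

## Index of checked content (prose only in docstrings)
§1 LOAD-BEARING ANALYSIS (drop one hypothesis at a time)
  * `birEveryGroundState_iff_avgHyp` — bookkeeping: the crux over the named pieces `AvgHyp`, `EveryGSLRO`.
  * `birEveryGroundState_false_without_lt` — drop `U₁ < U₂`: FALSE (empty window; vacuous hypothesis,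
    impossible `∃ U ∈ ∅`). Any proof uses the non-emptiness of the window (and only through `∃ U`).
  * `avgHyp_of_nonpos`, `withoutPosC_iff_denseEveryGS`, `withoutAvgHyp_iff_denseEveryGS`,
    `denseEveryGS_imp_birEveryGroundState`, `denseEveryGS_imp_summit` — drop `0 < c` (or the whole
    average hypothesis): the crux collapses to `DenseEveryGS` (every-GS d-wave LRO at a DENSE set of
    couplings for EVERY doping `δ ∈ (0,1/2)`), which implies the summit outright. So `0 < c` and the
    average hypothesis are load-bearing in the only possible sense: without them the crux is (more
    than) the open problem itself. Not refutable either (no dark-ground-state theorem exists).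
  * `δ ∈ (0,1/2)`, `0 < U₁`, `Even L`, `[NeZero L]`: NOT load-bearing for the truth value in any
    provable way (docstring of `AvgHyp`): at `δ ≥ 1` (`N = 0`, vacuum) and around `U = 0` (free
    fermions: Wick ⇒ GS-average `⟨Δ_d†Δ_d⟩ = O(L²)`) the hypothesis FAILS, so those instances are
    vacuously true, not false; attractive windows `U₂ ≤ 0` are as open as repulsive ones.
§2 NATURAL STRENGTHENINGS REFUTED IN FINITE MODELS
  * `exists_pencil_permanentDarkPartner` / `not_abstractDarkPartnerExclusion` — the MODEL-FREE
    skeleton of the intended mechanism (affine Hermitian pencil `T + U•V`; observable `Y ≥ 0`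
    invariant under EVERY symmetry of the pencil, known or hidden, i.e. `Y ∈ {T,V}''`; conclusion:
    at SOME coupling all ground vectors share one `Y`-Rayleigh quotient) is FALSE: an explicit 5×5
    INTEGER pencil (irreducible inequivalent blocks `M₂ ⊕ M₃`, bottom branch `-√(1+U²)` shared
    IDENTICALLY by both blocks, `Y = 0 ⊕ 1₃ = 2 - V² - TV²T`) has, at EVERY real `U`, a dark ground
    vector (`⟨Y⟩ = 0`) and a bright one (`⟨Y⟩ = 1`); the distinct-eigenvalue count is the constant 3,
    so "non-exceptional coupling" hypotheses (cf. `hdark`) do not rescue it. Consequence for provers: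
    Kato/Rellich + Schur + countability + integrality of the pencil CANNOT close the crux; the
    residual (`DarkPartnerExclusion` / `hgen` / `hirr`) must use structure of `(T_L, D_L, Δ_d)` that
    excludes isospectral-bottom inequivalent constituents — a Hubbard-specific theorem with no
    printed source (nearest calibration: Kippenhahn's conjecture is false, Laffey 1983; 2×2 pencils
    are rigid, Motzkin–Taussky).
  * `PointwiseTransferAt` / `not_pointwiseTransfer_L4` (NEAR-MISS, `sorry`, §4): "average bound ⇒
    bottom bound with the same constant at fixed `(U, L)`" is realised-false in the Hubbard family at
    the anomalous torus `L = 4`, `δ ∈ (3/8,1/2)` (`N = 8`): `dim E₀ = 3` at every `U ∈ [0.3,12]`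
    tested, `E₀ = ` k=0 swap-odd singlet ⊕ {(π,0),(0,π)} doublet (two INEQUIVALENT lattice irreps,
    hypercube symmetry `C₄□C₄ = Q₄`, `|Aut| = 384`), compression spectrum of `Δ_d†Δ_d` split
    `{0.031,0.031,0.093}` at `U = 0.5` (ED: kit j005707 by crux-ideator 3; j006585/j012468 by
    crux-ideator 1, same structure at `N = 4, 8`; `N = 6`: unique; `N = 10` (δ = 3/8, closed shell):
    unique, scalar, `U = 0.5`). Not kernel-checkable (Fock dimension 2³²), hence `sorry` with the
    evidence in the docstring; one size never touches a `liminf`, so this is NOT a refutation of the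
    crux — it shows any proof must use structure absent at `L = 4` (for `L ≠ 4`,
    `Aut(C_L□C_L)` is the lattice group: Imrich–Klavžar–Rall 2008).
§3 TARGETS (lead's stuck stubs): none this cycle (`payload.targets = []`, no line picked).
§4 NEAR-MISSES / WHY IT RESISTS (docstrings of `not_pointwiseTransfer_L4`, `resists`).

## Attacks run this cycle (census; details in the seat's NOTES.md)
junk hunt on every operator of the signature (clean, re-derived from tree lemmas); hypothesis
drops (above); abstract finite models (§2); ED evidence audit of the three ideator scans (L = 4 only
reachable at the crux's fillings; `L = 6` at `(1-δ) > 1/2` has sector dimension `≥ C(36,10)² ≈ 6·10¹⁵`,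
out of reach of exact methods — the physically relevant regime is computationally inaccessible, the
second reason the crux resists); literature: no printed theorem on ground-state (non)degeneracy of
doped repulsive Hubbard tori in a fixed `(N,S^z)` sector beyond Lieb 1989 (half filling / U<0),
Bruus–Anglès d'Auriac 1997 (numerics, L ≤ 6 dilute), Futami 2025 (no LOCAL conserved charges —
silent on non-local hidden symmetries); saturated ferromagnetism would give PERFECTLY DARK sector
ground states (`Δ_d` kills the S = N/2 multiplet) but is proved nowhere in this regime (Nagaoka:
one hole, U = ∞) and would break the HYPOTHESIS, not the conclusion.
-/

noncomputable section

namespace Summit.HubbardSuperconductivity.HubbardSuperconductivity.Cruxes.BirEveryGroundState.Disproof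

open Matrix Finset Filter
open Literature.Probability.LatticeModels Literature.MathematicalPhysics.QuantumLattice
open Summit.HubbardSuperconductivity.HubbardSuperconductivity.Theses.BalabanIR
open Summit.HubbardSuperconductivity.HubbardSuperconductivity.Theorems
open scoped ComplexOrder

/-! ## §1 Load-bearing analysis -/

section LoadBearing

/-- The window-average hypothesis of the crux at one coupling: data `(δ, U, c)`; eventually in even
`L`, `c·L⁴·Re tr P ≤ Re tr (P Δ_d† Δ_d)` with `P` the projection onto the sector ground eigenspace
(the `let`-block of the route decl, verbatim). JUNK AUDIT (all clean): `Re tr P ≥ 1` for `δ ≥ -1`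
(`one_le_re_trace_groundProj_hubbardTorus`: the sector `(2⌊(1-δ)L²/2⌋, 0)` is non-empty and `H`
preserves it); `0 ≤ Re tr (P Δ†Δ) ≤ C_d² L⁴ Re tr P` (`re_trace_sectorGroundProj_mul_pairField_mem_Icc`),
so `c ≤ C_d²` is forced and `L⁴` is the right power; `⌊·⌋₊` of a nonnegative real, no `ℕ`-subtraction,
no division. NOT load-bearing for truth (only for matching the summit): the range `δ ∈ (0,1/2)` —
at `δ ≥ 1` the sector is the vacuum (`N = 0`, `Δ_d ψ = 0`, hypothesis false ⇒ instance vacuous), at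
`δ ≤ -1` the filled band; `0 < U₁` — a window around `U = 0` contains free fermions whose GS-average
pair structure factor is `O(L²)` by Wick's rule (hypothesis false again); purely attractive windows are
as open as repulsive ones. [folklore] -/
def AvgHyp (δ U c : ℝ) : Prop :=
  ∃ L₀ : ℕ, ∀ (L : ℕ) [NeZero L], L₀ ≤ L → Even L →
    let N : ℕ := 2 * ⌊(1 - δ) * (L : ℝ) ^ 2 / 2⌋₊
    let H := hubbardTorus 2 L 1 U
    let S := szSector (Λ := FermionTorus 2 L) N 0
    let E₀ := S ⊓ Module.End.eigenspace (Matrix.toLin' H) ((H.minEnergyOn S : ℝ) : ℂ)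
    let P := projMatrix (E₀.map (Fock.toEuclidean (ι := Orb (FermionTorus 2 L)) :
      Fock (Orb (FermionTorus 2 L)) →ₗ[ℂ] EuclideanSpace ℂ (Finset (Orb (FermionTorus 2 L)))))
    c * (L : ℝ) ^ 4 * P.trace.re ≤
      (P * ((pairField dWaveFormFactor L)ᴴ * pairField dWaveFormFactor L)).trace.re

/-- The conclusion of the crux at one coupling: the summit's matrix `HasDWavePairFieldLROAt U δ`,
verbatim body (EVERY admissible normalised sector ground-state sequence has `d_{x²-y²}` pair-field
LRO along the even sides). JUNK AUDIT: admissible sequences exist at every `U` (a sector ground state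
at every even `L`, the vacuum at `L = 0`); the LRO sequence is bounded (`0 ≤ · ≤ C_d²`), so the
`liminf` is honest; by `Theorems.forall_hasLRO_iff_groundState_bound` this clause is EQUIVALENT to an
eventual uniform bound `c' L⁴ ≤ re ⟨ψ, Δ_d†Δ_d ψ⟩` on every unit sector ground state. [folklore] -/
def EveryGSLRO (U δ : ℝ) : Prop :=
  ∀ (N : ℕ → ℕ) (ψ : ∀ L, Fock (Orb (FermionTorus 2 L))),
    (∀ L, Even L → N L = 2 * ⌊(1 - δ) * (L : ℝ) ^ 2 / 2⌋₊ ∧ star (ψ L) ⬝ᵥ ψ L = 1 ∧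
      IsGroundStateInSector (hubbardTorus 2 L 1 U) (N L) 0 (ψ L)) →
    HasLongRangeOrder (fun k => halfOpenBox 2 (2 * k))
      (fun k => torusPullback (pairFieldCorr dWaveFormFactor ψ) (2 * k))

/-- Bookkeeping: the crux is `∀ data, (∀ U ∈ window, AvgHyp δ U c) → ∃ U ∈ window, EveryGSLRO U δ`
(definitional unfolding of the route decl). [folklore] -/
theorem birEveryGroundState_iff_avgHyp :
    BirEveryGroundState ↔
      ∀ (δ U₁ U₂ c : ℝ), δ ∈ Set.Ioo (0:ℝ) (1/2) → 0 < U₁ → U₁ < U₂ → 0 < c →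
        (∀ U ∈ Set.Ioo U₁ U₂, AvgHyp δ U c) → ∃ U ∈ Set.Ioo U₁ U₂, EveryGSLRO U δ :=
  Iff.rfl

/-- **`0 < c` is what gives the hypothesis content.** For `c ≤ 0` (and any `δ ≥ -1`, any `U`) the
window-average inequality holds at every even side `L ≥ 1`: its left side is `≤ 0`
(`Re tr P ≥ 1 ≥ 0`) and its right side is `≥ 0` (`Δ_d†Δ_d ≥ 0` compressed to `E₀`). [folklore] -/
theorem avgHyp_of_nonpos {δ c : ℝ} (U : ℝ) (hδ : -1 ≤ δ) (hc : c ≤ 0) : AvgHyp δ U c := by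
  refine ⟨0, fun L _ _ _ => ?_⟩
  intro N H S E₀ P
  have hP : 1 ≤ P.trace.re := one_le_re_trace_groundProj_hubbardTorus L 1 U δ hδ
  have h0 : 0 ≤ (P * ((pairField dWaveFormFactor L)ᴴ * pairField dWaveFormFactor L)).trace.re :=
    (re_trace_sectorGroundProj_mul_pairField_mem_Icc dWaveFormFactor L H N 0).1
  have h1 : 0 ≤ (L : ℝ) ^ 4 * P.trace.re := by
    have : (0 : ℝ) ≤ P.trace.re := by linarith
    positivity
  have h2 : c * (L : ℝ) ^ 4 * P.trace.re ≤ 0 := by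
    rw [mul_assoc]
    exact mul_nonpos_of_nonpos_of_nonneg hc h1
  linarith

/-- Every-GS `d`-wave pair LRO at a DENSE set of couplings for EVERY doping `δ ∈ (0,1/2)`:
what the crux becomes when `0 < c` (or the average hypothesis) is dropped. Strictly stronger than
the summit (`denseEveryGS_imp_summit`); open, and no more refutable than the summit. [folklore] -/
def DenseEveryGS : Prop :=
  ∀ δ ∈ Set.Ioo (0:ℝ) (1/2), ∀ U₁ U₂ : ℝ, 0 < U₁ → U₁ < U₂ → ∃ U ∈ Set.Ioo U₁ U₂, EveryGSLRO U δ

/-- The crux with the hypothesis `0 < c` dropped. [folklore] -/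
def BirEveryGroundStateWithoutPosC : Prop :=
  ∀ (δ U₁ U₂ c : ℝ), δ ∈ Set.Ioo (0:ℝ) (1/2) → 0 < U₁ → U₁ < U₂ →
    (∀ U ∈ Set.Ioo U₁ U₂, AvgHyp δ U c) → ∃ U ∈ Set.Ioo U₁ U₂, EveryGSLRO U δ

/-- The crux with the whole window-average hypothesis dropped. [folklore] -/
def BirEveryGroundStateWithoutAvgHyp : Prop :=
  ∀ (δ U₁ U₂ : ℝ), δ ∈ Set.Ioo (0:ℝ) (1/2) → 0 < U₁ → U₁ < U₂ → ∃ U ∈ Set.Ioo U₁ U₂, EveryGSLRO U δ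

/-- **Dropping `0 < c` turns the crux into `DenseEveryGS`** (take `c = 0`, where the hypothesis is
free by `avgHyp_of_nonpos`). So any proof must use `0 < c` — and can use it only through the
size of `Re tr (P Δ†Δ)`, i.e. through genuine pair order of SOME ground states. [folklore] -/
theorem withoutPosC_iff_denseEveryGS : BirEveryGroundStateWithoutPosC ↔ DenseEveryGS := by
  constructor
  · intro h δ hδ U₁ U₂ hU₁ hU₁₂
    exact h δ U₁ U₂ 0 hδ hU₁ hU₁₂ fun U _ => avgHyp_of_nonpos U (by linarith [hδ.1]) le_rfl
  · intro h δ U₁ U₂ _ hδ hU₁ hU₁₂ _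
    exact h δ hδ U₁ U₂ hU₁ hU₁₂

/-- Dropping the average hypothesis altogether gives the same statement `DenseEveryGS`. [folklore] -/
theorem withoutAvgHyp_iff_denseEveryGS : BirEveryGroundStateWithoutAvgHyp ↔ DenseEveryGS :=
  ⟨fun h δ hδ U₁ U₂ hU₁ hU₁₂ => h δ U₁ U₂ hδ hU₁ hU₁₂,
    fun h δ U₁ U₂ hδ hU₁ hU₁₂ => h δ hδ U₁ U₂ hU₁ hU₁₂⟩

/-- `DenseEveryGS` implies the crux (ignore the hypothesis). [folklore] -/
theorem denseEveryGS_imp_birEveryGroundState (h : DenseEveryGS) : BirEveryGroundState :=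
  fun δ U₁ U₂ _ hδ hU₁ hU₁₂ _ _ => h δ hδ U₁ U₂ hU₁ hU₁₂

/-- `DenseEveryGS` implies the SUMMIT (`δ = 1/4`, window `(1,2)`): the `c`-free crux is not a lemma
towards the summit but a strengthening of it. [folklore] -/
theorem denseEveryGS_imp_summit (h : DenseEveryGS) : _root_.HubbardSuperconductivity := by
  obtain ⟨U, hU, hLRO⟩ := h (1/4) ⟨by norm_num, by norm_num⟩ 1 2 one_pos one_lt_two
  show Literature.Hubbard.DWaveSuperconductivityHubbard
  exact ⟨U, lt_trans one_pos hU.1, 1/4, ⟨by norm_num, by norm_num⟩, hLRO⟩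

/-- The crux with the hypothesis `U₁ < U₂` dropped. [folklore] -/
def BirEveryGroundStateWithoutLt : Prop :=
  ∀ (δ U₁ U₂ c : ℝ), δ ∈ Set.Ioo (0:ℝ) (1/2) → 0 < U₁ → 0 < c →
    (∀ U ∈ Set.Ioo U₁ U₂, AvgHyp δ U c) → ∃ U ∈ Set.Ioo U₁ U₂, EveryGSLRO U δ

/-- **Any proof must use `U₁ < U₂`.** Without it the statement is FALSE: at `U₁ = U₂ = 1`
(`δ = 1/4`, `c = 1`) the window is empty, the hypothesis is vacuous and the conclusion asks for
`U ∈ (1,1) = ∅`. (Witness of the obvious; recorded so that the quantifier bookkeeping of every line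
keeps the window non-degenerate — e.g. a restatement "for all but countably many U" must still
exhibit one.) [folklore] -/
theorem birEveryGroundState_false_without_lt : ¬ BirEveryGroundStateWithoutLt := by
  intro h
  obtain ⟨U, hU, -⟩ := h (1/4) 1 1 1 ⟨by norm_num, by norm_num⟩ one_pos one_pos
    (fun U hU => absurd hU.2 (not_lt.mpr hU.1.le))
  exact absurd hU.2 (not_lt.mpr hU.1.le)

end LoadBearing

/-! ## §2 Natural strengthenings refuted in finite models -/

section Abstract

/-- A ground vector of a (Hermitian) matrix, in variational form: a nonzero eigenvector whose
eigenvalue is a lower bound of the quadratic form. [folklore] -/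
def IsGroundVec {m : ℕ} (H : Matrix (Fin m) (Fin m) ℂ) (ψ : Fin m → ℂ) : Prop :=
  ψ ≠ 0 ∧ ∃ e : ℝ, H *ᵥ ψ = (e : ℂ) • ψ ∧
    ∀ χ : Fin m → ℂ, e * (star χ ⬝ᵥ χ).re ≤ (star χ ⬝ᵥ H *ᵥ χ).re

/-- **The model-free skeleton of the crux mechanism** (Kato–Rellich branches + Schur over ALL
symmetries + pick a good coupling), as a statement about affine Hermitian pencils: if `Y ≥ 0`
commutes with every matrix commuting with `T` and `V` (so `Y` is invariant under every symmetry of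
the pencil `T + U•V`, known or hidden — `Y ∈ {T,V}''`), then at SOME real coupling `U` all ground
vectors of `T + U•V` have the same `Y`-Rayleigh quotient (no dark/bright pair). This is what
`DarkPartnerExclusion` / `hgen` / `hirr` would follow from if genericity alone sufficed.
REFUTED below (`not_abstractDarkPartnerExclusion`). [folklore] -/
def AbstractDarkPartnerExclusion : Prop :=
  ∀ (m : ℕ) (T V Y : Matrix (Fin m) (Fin m) ℂ), T.IsHermitian → V.IsHermitian → Y.PosSemidef →
    (∀ X : Matrix (Fin m) (Fin m) ℂ, X * T = T * X → X * V = V * X → X * Y = Y * X) →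
    ∃ U : ℝ, ∀ ψ φ : Fin m → ℂ,
      IsGroundVec (T + (U : ℂ) • V) ψ → IsGroundVec (T + (U : ℂ) • V) φ →
      (star ψ ⬝ᵥ Y *ᵥ ψ) * (star φ ⬝ᵥ φ) = (star φ ⬝ᵥ Y *ᵥ φ) * (star ψ ⬝ᵥ ψ)

/-- Hopping-like part of the counterexample pencil: `σₓ ⊕ flip(e₃,e₄) ⊕ 0`. [folklore] -/
def cexT : Matrix (Fin 5) (Fin 5) ℂ :=
  !![0, 1, 0, 0, 0; 1, 0, 0, 0, 0; 0, 0, 0, 1, 0; 0, 0, 1, 0, 0; 0, 0, 0, 0, 0]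

/-- Interaction-like part of the counterexample pencil: `σ_z ⊕ flip(e₃,e₅)`. [folklore] -/
def cexV : Matrix (Fin 5) (Fin 5) ℂ :=
  !![1, 0, 0, 0, 0; 0, -1, 0, 0, 0; 0, 0, 0, 0, 1; 0, 0, 0, 0, 0; 0, 0, 1, 0, 0]

/-- The observable: the projection onto the second block, `0₂ ⊕ 1₃`. [folklore] -/
def cexY : Matrix (Fin 5) (Fin 5) ℂ := Matrix.diagonal ![0, 0, 1, 1, 1]

/-- The pencil `cexT + U • cexV` written out: blocks `[[U,1],[1,-U]]` (eigenvalues `±√(1+U²)`) and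
`[[0,1,U],[1,0,0],[U,0,0]]` (eigenvalues `-√(1+U²), 0, √(1+U²)`; `det ≡ 0` with the rotating kernel
vector `(0,U,-1)` and no common invariant subspace). [folklore] -/
def cexH (U : ℝ) : Matrix (Fin 5) (Fin 5) ℂ :=
  !![(U : ℂ), 1, 0, 0, 0; 1, -(U : ℂ), 0, 0, 0; 0, 0, 0, 1, (U : ℂ); 0, 0, 1, 0, 0; 0, 0, (U : ℂ), 0, 0]

theorem cexH_eq (U : ℝ) : cexT + (U : ℂ) • cexV = cexH U := by
  ext i j
  fin_cases i <;> fin_cases j <;> simp [cexT, cexV, cexH]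

theorem cexT_isHermitian : cexT.IsHermitian := by
  unfold Matrix.IsHermitian
  ext i j
  fin_cases i <;> fin_cases j <;> simp [cexT, Matrix.conjTranspose_apply]

theorem cexV_isHermitian : cexV.IsHermitian := by
  unfold Matrix.IsHermitian
  ext i j
  fin_cases i <;> fin_cases j <;> simp [cexV, Matrix.conjTranspose_apply]

theorem cexY_posSemidef : cexY.PosSemidef := by
  rw [cexY, Matrix.posSemidef_diagonal_iff]
  intro i
  fin_cases i <;> simp

/-- `Y` is a noncommutative polynomial in `T, V`: `Y = 2 - V² - T V² T`. [folklore] -/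
theorem cexY_eq : cexY = (2 : ℂ) • (1 : Matrix (Fin 5) (Fin 5) ℂ) - cexV * cexV -
    cexT * cexV * cexV * cexT := by
  ext i j
  fin_cases i <;> fin_cases j <;>
    simp [cexY, cexT, cexV] <;> norm_num

/-- Hence `Y` commutes with everything that commutes with `T` and `V` (it is invariant under every
symmetry of the pencil). [folklore] -/
theorem cex_commute (X : Matrix (Fin 5) (Fin 5) ℂ) (hT : X * cexT = cexT * X)
    (hV : X * cexV = cexV * X) : X * cexY = cexY * X := by
  have key : ∀ A B : Matrix (Fin 5) (Fin 5) ℂ, X * A = A * X → X * B = B * X →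
      X * (A * B) = A * B * X := by
    intro A B hA hB
    rw [← mul_assoc, hA, mul_assoc, hB, ← mul_assoc]
  have hVV : X * (cexV * cexV) = cexV * cexV * X := key _ _ hV hV
  have hTV : X * (cexT * cexV) = cexT * cexV * X := key _ _ hT hV
  have hTVV : X * (cexT * cexV * cexV) = cexT * cexV * cexV * X := key _ _ hTV hV
  have hTVVT : X * (cexT * cexV * cexV * cexT) = cexT * cexV * cexV * cexT * X := key _ _ hTVV hT
  rw [cexY_eq, mul_sub, mul_sub, sub_mul, sub_mul, hVV, hTVVT, Matrix.mul_smul, Matrix.smul_mul,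
    Matrix.mul_one, Matrix.one_mul]

/-- The dark ground vector (block 1) at coupling `U`, `s = √(1+U²)`. [folklore] -/
def cexψ (U s : ℝ) : Fin 5 → ℂ := ![1, -((U : ℂ) + s), 0, 0, 0]

/-- The bright ground vector (block 2) at coupling `U`, `s = √(1+U²)`. [folklore] -/
def cexφ (U s : ℝ) : Fin 5 → ℂ := ![0, 0, (s : ℂ), -1, -(U : ℂ)]

theorem cexH_mulVec_ψ (U s : ℝ) (hs : s ^ 2 = 1 + U ^ 2) :
    cexH U *ᵥ cexψ U s = ((-s : ℝ) : ℂ) • cexψ U s := by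
  have hsc : (s : ℂ) ^ 2 = 1 + (U : ℂ) ^ 2 := by exact_mod_cast hs
  ext i
  fin_cases i <;> simp [cexH, cexψ, Matrix.mulVec, dotProduct, Fin.sum_univ_five]
  linear_combination (-1 : ℂ) * hsc

theorem cexH_mulVec_φ (U s : ℝ) (hs : s ^ 2 = 1 + U ^ 2) :
    cexH U *ᵥ cexφ U s = ((-s : ℝ) : ℂ) • cexφ U s := by
  have hsc : (s : ℂ) ^ 2 = 1 + (U : ℂ) ^ 2 := by exact_mod_cast hs
  ext i
  fin_cases i <;> simp [cexH, cexφ, Matrix.mulVec, dotProduct, Fin.sum_univ_five]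
  · linear_combination hsc
  · ring

/-- The variational inequality: `-√(1+U²)` is the bottom of `cexH U` (sum-of-squares certificate
`s·(⟨χ,Hχ⟩ + s‖χ‖²) = s(U+s)|χ₀+(s-U)χ₁|² + |χ₂+sχ₃|² + |Uχ₂+sχ₄|²`). [folklore] -/
theorem cexH_variational (U s : ℝ) (hs : s ^ 2 = 1 + U ^ 2) (hs0 : 0 < s) (χ : Fin 5 → ℂ) :
    (-s) * (star χ ⬝ᵥ χ).re ≤ (star χ ⬝ᵥ cexH U *ᵥ χ).re := by
  have hsU : 0 ≤ U + s := by nlinarith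
  -- the five components of `H χ`
  have h0 : (cexH U *ᵥ χ) 0 = (U : ℂ) * χ 0 + χ 1 := by
    simp [cexH, Matrix.mulVec, dotProduct, Fin.sum_univ_five]; try ring
  have h1 : (cexH U *ᵥ χ) 1 = χ 0 - (U : ℂ) * χ 1 := by
    simp [cexH, Matrix.mulVec, dotProduct, Fin.sum_univ_five]; try ring
  have h2 : (cexH U *ᵥ χ) 2 = χ 3 + (U : ℂ) * χ 4 := by
    simp [cexH, Matrix.mulVec, dotProduct, Fin.sum_univ_five]; try ring
  have h3 : (cexH U *ᵥ χ) 3 = χ 2 := by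
    simp [cexH, Matrix.mulVec, dotProduct, Fin.sum_univ_five]; try ring
  have h4 : (cexH U *ᵥ χ) 4 = (U : ℂ) * χ 2 := by
    simp [cexH, Matrix.mulVec, dotProduct, Fin.sum_univ_five]; try ring
  -- real coordinates
  set a := (χ 0).re with ha
  set a' := (χ 0).im with ha'
  set b := (χ 1).re with hb
  set b' := (χ 1).im with hb'
  set c := (χ 2).re with hc
  set c' := (χ 2).im with hc'
  set d := (χ 3).re with hd
  set d' := (χ 3).im with hd'
  set e := (χ 4).re with he
  set e' := (χ 4).im with he'
  have hre : (star χ ⬝ᵥ cexH U *ᵥ χ).re =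
      U * (a ^ 2 + a' ^ 2) - U * (b ^ 2 + b' ^ 2) + 2 * (a * b + a' * b') +
        2 * (c * d + c' * d') + 2 * U * (c * e + c' * e') := by
    simp only [dotProduct, Fin.sum_univ_five, Pi.star_apply, h0, h1, h2, h3, h4, Complex.add_re,
      Complex.mul_re, Complex.mul_im, Complex.sub_re, Complex.sub_im, Complex.star_def,
      Complex.conj_re, Complex.conj_im, Complex.ofReal_re, Complex.ofReal_im, Complex.add_im]
    ring
  have hn : (star χ ⬝ᵥ χ).re = a ^ 2 + a' ^ 2 + (b ^ 2 + b' ^ 2) + (c ^ 2 + c' ^ 2) +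
      (d ^ 2 + d' ^ 2) + (e ^ 2 + e' ^ 2) := by
    simp only [dotProduct, Fin.sum_univ_five, Pi.star_apply, Complex.add_re, Complex.mul_re,
      Complex.star_def, Complex.conj_re, Complex.conj_im]
    ring
  -- sum-of-squares certificate: `s·(⟨χ,Hχ⟩ + s‖χ‖²) = s(U+s)|χ₀+(s-U)χ₁|² + |χ₂+sχ₃|² + |Uχ₂+sχ₄|²`
  have key : s * ((star χ ⬝ᵥ cexH U *ᵥ χ).re + s * (star χ ⬝ᵥ χ).re) =
      s * (U + s) * ((a + (s - U) * b) ^ 2 + (a' + (s - U) * b') ^ 2) +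
        ((c + s * d) ^ 2 + (c' + s * d') ^ 2) + ((U * c + s * e) ^ 2 + (U * c' + s * e') ^ 2) := by
    rw [hre, hn]
    linear_combination
      (-(2 * s * (a * b + a' * b') + s * (s - U) * (b ^ 2 + b' ^ 2) - (c ^ 2 + c' ^ 2))) * hs
  have hnonneg : 0 ≤ s * ((star χ ⬝ᵥ cexH U *ᵥ χ).re + s * (star χ ⬝ᵥ χ).re) := by
    rw [key]; positivity
  have h := (mul_nonneg_iff_of_pos_left hs0).mp hnonneg
  linarith

theorem cexψ_ne_zero (U s : ℝ) : cexψ U s ≠ 0 := fun h => by simpa [cexψ] using congrFun h 0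

theorem cexφ_ne_zero (U s : ℝ) : cexφ U s ≠ 0 := fun h => by simpa [cexφ] using congrFun h 3

theorem isGroundVec_cexψ (U s : ℝ) (hs : s ^ 2 = 1 + U ^ 2) (hs0 : 0 < s) :
    IsGroundVec (cexT + (U : ℂ) • cexV) (cexψ U s) := by
  rw [cexH_eq]
  exact ⟨cexψ_ne_zero U s, -s, cexH_mulVec_ψ U s hs, cexH_variational U s hs hs0⟩

theorem isGroundVec_cexφ (U s : ℝ) (hs : s ^ 2 = 1 + U ^ 2) (hs0 : 0 < s) :
    IsGroundVec (cexT + (U : ℂ) • cexV) (cexφ U s) := by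
  rw [cexH_eq]
  exact ⟨cexφ_ne_zero U s, -s, cexH_mulVec_φ U s hs, cexH_variational U s hs hs0⟩

/-- `ψ` is dark: `⟨ψ, Y ψ⟩ = 0`. [folklore] -/
theorem cexψ_dark (U s : ℝ) : star (cexψ U s) ⬝ᵥ cexY *ᵥ cexψ U s = 0 := by
  simp [cexψ, cexY, Matrix.mulVec_diagonal, dotProduct, Fin.sum_univ_five]

/-- `φ` is bright: `⟨φ, Y φ⟩ = ⟨φ, φ⟩`. [folklore] -/
theorem cexφ_bright (U s : ℝ) :
    star (cexφ U s) ⬝ᵥ cexY *ᵥ cexφ U s = star (cexφ U s) ⬝ᵥ cexφ U s := by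
  simp [cexφ, cexY, Matrix.mulVec_diagonal, dotProduct, Fin.sum_univ_five]

theorem star_cexψ_dotProduct (U s : ℝ) :
    star (cexψ U s) ⬝ᵥ cexψ U s = ((1 + (U + s) ^ 2 : ℝ) : ℂ) := by
  simp [cexψ, dotProduct, Fin.sum_univ_five, ← Complex.ofReal_add, ← Complex.ofReal_neg,
    Complex.conj_ofReal]
  push_cast
  ring

theorem star_cexφ_dotProduct (U s : ℝ) :
    star (cexφ U s) ⬝ᵥ cexφ U s = ((s ^ 2 + 1 + U ^ 2 : ℝ) : ℂ) := by
  simp [cexφ, dotProduct, Fin.sum_univ_five, Complex.conj_ofReal]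
  ring

/-- **A permanent dark partner invariant under all symmetries.** For the integer pencil
`cexT + U • cexV` and the observable `cexY ∈ {cexT, cexV}''`, at EVERY real coupling there are two
ground vectors with `Y`-Rayleigh quotients `0` and `1`. (Blocks `M₂ ⊕ M₃`, irreducible and
inequivalent, sharing the bottom branch `-√(1+U²)` identically; three distinct eigenvalues at every
`U`, so no coupling is "exceptional".) [folklore] -/
theorem exists_pencil_permanentDarkPartner :
    ∃ (T V Y : Matrix (Fin 5) (Fin 5) ℂ), T.IsHermitian ∧ V.IsHermitian ∧ Y.PosSemidef ∧
      (∀ X : Matrix (Fin 5) (Fin 5) ℂ, X * T = T * X → X * V = V * X → X * Y = Y * X) ∧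
      ∀ U : ℝ, ∃ ψ φ : Fin 5 → ℂ,
        IsGroundVec (T + (U : ℂ) • V) ψ ∧ IsGroundVec (T + (U : ℂ) • V) φ ∧
        star ψ ⬝ᵥ Y *ᵥ ψ = 0 ∧ star φ ⬝ᵥ Y *ᵥ φ = star φ ⬝ᵥ φ ∧
        star ψ ⬝ᵥ ψ ≠ 0 ∧ star φ ⬝ᵥ φ ≠ 0 := by
  refine ⟨cexT, cexV, cexY, cexT_isHermitian, cexV_isHermitian, cexY_posSemidef, cex_commute, ?_⟩
  intro U
  set s : ℝ := Real.sqrt (1 + U ^ 2) with hs_def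
  have hs : s ^ 2 = 1 + U ^ 2 := by
    rw [hs_def, Real.sq_sqrt (by positivity)]
  have hs0 : 0 < s := by
    rw [hs_def]
    exact Real.sqrt_pos.mpr (by positivity)
  refine ⟨cexψ U s, cexφ U s, isGroundVec_cexψ U s hs hs0, isGroundVec_cexφ U s hs hs0,
    cexψ_dark U s, cexφ_bright U s, ?_, ?_⟩
  · rw [star_cexψ_dotProduct]
    exact_mod_cast (show (1 + (U + s) ^ 2 : ℝ) ≠ 0 by positivity)
  · rw [star_cexφ_dotProduct]
    exact_mod_cast (show (s ^ 2 + 1 + U ^ 2 : ℝ) ≠ 0 by positivity)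

/-- **The model-free mechanism is false.** Genericity in `U`, integrality of the pencil, analytic
branches and Schur over the FULL commutant do not exclude a permanent dark ground partner: any proof
of `BirEveryGroundState` along the Kato–Schur line must prove a HUBBARD-SPECIFIC exclusion of
isospectral-bottom inequivalent constituents of `alg(T_L, D_L)` for cofinitely many even `L`
(the typed residual `hdark` of `Theorems.birEveryGroundState_of_darkPartnerExclusion`), for which no
printed source exists. Calibration: 2×2 pencils are rigid (Motzkin–Taussky), Kippenhahn's conjecture
fails from 8×8 (Laffey 1983); this 5×5 block example is the minimal shape `2 ⊕ 3` of the reducible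
failure. [folklore] -/
theorem not_abstractDarkPartnerExclusion : ¬ AbstractDarkPartnerExclusion := by
  intro h
  obtain ⟨T, V, Y, hT, hV, hY, hcomm, hall⟩ := exists_pencil_permanentDarkPartner
  obtain ⟨U, hU⟩ := h 5 T V Y hT hV hY hcomm
  obtain ⟨ψ, φ, hψ, hφ, hdark, hbright, hψ0, hφ0⟩ := hall U
  have := hU ψ φ hψ hφ
  rw [hdark, hbright, zero_mul] at this
  exact mul_ne_zero hφ0 hψ0 this.symm

end Abstract

/-! ## §4 Near-misses and why the crux resists -/

section NearMiss

/-- POINTWISE TRANSFER at `(δ, U, L, c)`: the average bound at one size forces the bottom bound with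
the same constant on the same ground eigenspace (⇔ the compression of `Δ_d†Δ_d` to `E₀(U,L)` has
no eigenvalue below its mean, e.g. because it is a scalar). The crux needs this only eventually in
`L`, at one `U` of each window, and with a loss `c ↦ c'`; this is the natural size-wise strengthening.
[folklore] -/
def PointwiseTransferAt (δ U : ℝ) (L : ℕ) [NeZero L] (c : ℝ) : Prop :=
  let N : ℕ := 2 * ⌊(1 - δ) * (L : ℝ) ^ 2 / 2⌋₊
  let H := hubbardTorus 2 L 1 U
  let S := szSector (Λ := FermionTorus 2 L) N 0
  let E₀ := S ⊓ Module.End.eigenspace (Matrix.toLin' H) ((H.minEnergyOn S : ℝ) : ℂ)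
  let P := projMatrix (E₀.map (Fock.toEuclidean (ι := Orb (FermionTorus 2 L)) :
    Fock (Orb (FermionTorus 2 L)) →ₗ[ℂ] EuclideanSpace ℂ (Finset (Orb (FermionTorus 2 L)))))
  c * (L : ℝ) ^ 4 * P.trace.re ≤
      (P * ((pairField dWaveFormFactor L)ᴴ * pairField dWaveFormFactor L)).trace.re →
    ∀ ψ ∈ E₀, star ψ ⬝ᵥ ψ = 1 →
      c * (L : ℝ) ^ 4 ≤ (star ψ ⬝ᵥ ((pairField dWaveFormFactor L)ᴴ * pairField dWaveFormFactor L) *ᵥ ψ).re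

/-- **NEAR-MISS (not kernel-checkable; `sorry` by the rules of this work file).** At the anomalous
torus `L = 4` and `δ = 7/16 ∈ (3/8, 1/2)` (`N = 8`), pointwise transfer FAILS at `U = 1/2` for the
constant `c = mean/4⁴`: exact diagonalisation (kit j005707, crux-ideator 3, Lanczos in the
`(4,4)`-electron `S^z = 0` sector, degeneracy threshold 1e-7; independently j006585/j012468,
crux-ideator 1, deflated ARPACK, residuals ≤ 1e-11) finds `dim E₀ = 3` at EVERY coupling
`U ∈ {0.3,…,12}`: a `k = 0` singlet odd under `x ↔ y` plus the `{(π,0),(0,π)}` doublet — two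
INEQUIVALENT irreps of the lattice group, glued by the hypercube symmetry `C₄□C₄ ≅ Q₄` (`|Aut| = 384`)
— with compression spectrum of `Δ_d†Δ_d` equal to `{0.0312, 0.0312, 0.0934}` at `U = 0.5`
(`{0.0262, 0.0262, 0.0619}` at `U = 12`): mean `0.052 >` bottom `0.031`. OBSTRUCTION to closing it
here: the statement lives on a `2³²`-dimensional Fock space built from `Finset (Orb Λ) → ℂ` with
noncomputable reals — no `decide`, and a `norm_num` unfolding is hopeless; a certificate route
(export `H|_sector`, the three eigenvectors and an interval enclosure, then check residuals in Lean)
would still need the sector restriction of `hubbardTorus` as a computable matrix, which the tree does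
not provide. WHY IT DOES NOT KILL THE CRUX: one size never touches a `liminf`; for `L ≠ 4` the graph
automorphism group of the torus is the lattice group (Imrich–Klavžar–Rall 2008), and at the crux's
other `L = 4` fillings the ground state is unique (`N = 6`; `N = 10`, δ = 3/8, closed shell,
`U = 0.5`). Value for provers: any proof of the residual must use structure absent at `L = 4`.
[folklore] -/
theorem not_pointwiseTransfer_L4 :
    ¬ ∀ U ∈ Set.Ioo (0.3 : ℝ) 12, ∀ c : ℝ, PointwiseTransferAt (7/16) U 4 c := by
  sorry

/-- **WHY THE CRUX RESISTS (standing summary for the provers), as a checked tautology carrying the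
docstring.** (1) LOGICAL INSULATION: `¬S` ⇔ `∃` window with the average hypothesis TRUE and dark
ground states i.o. at every coupling (`exists_darkGroundStates_of_not_birEveryGroundState`); the
first conjunct is the route's open target on a window, so no unconditional refutation can exist before
the target itself is proved somewhere — and then the crux is moot. (2) NO JUNK: every operator of the
signature was re-audited (docstrings of `AvgHyp`, `EveryGSLRO`). (3) THE RESIDUAL IS NOT GENERIC
NONSENSE: `not_abstractDarkPartnerExclusion` — symmetry + genericity + integrality admit permanent
dark partners; the needed input is Hubbard-specific and absent from print. (4) THE ENEMY IS REAL BUT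
CONFINED: `L = 4` realises average ≠ every permanently (`not_pointwiseTransfer_L4`, ED evidence),
through a symmetry that exists at no other size; non-local hidden symmetries at `L ≥ 6` are neither
excluded (Futami 2025 covers local charges only) nor exhibited (ED census j005927: none at dilute
`L = 6, 8`; the crux's fillings at `L ≥ 6` are beyond exact methods). (5) PHYSICAL DARK STATES break
the hypothesis, not the conclusion: the `S = N/2` multiplet is annihilated by the singlet pair field,
so a saturated-ferromagnetic window would make the crux VACUOUSLY TRUE there; likewise free fermions
(`U = 0`, Wick: `O(L²)`). Net: the crux is exactly as hard as deciding whether doped repulsive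
Hubbard tori have, at one transcendental coupling per window, asymptotically scalar ground
compressions of `Δ_d†Δ_d` — open, with evidence mildly in favour away from `L = 4`. [folklore] -/
theorem resists : BirEveryGroundState ∨ ¬ BirEveryGroundState := em _

end NearMiss

end Summit.HubbardSuperconductivity.HubbardSuperconductivity.Cruxes.BirEveryGroundState.Disproof
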